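import Literature.Probability.LatticeModels.PolymerGasGeometric
import Summits.QuantumFields.BalabanUV.T4Continuum.Spine.NE7.QLaCensus

/-!
# Spine/NE7/QLaCensusDecay — reading (b) of NODE S's ledger census: the PRINTED per-cube census (0.26) is the tree's
# lattice-animal bound, so `T4RecentScale.Multiplicity` follows from two FORMAT facts (domains are CONNECTED cell sets;
# their weights DECAY geometrically in the cell count) on any bounded-degree cell adjacency

Cell `pub-balaban-gaps` (YM blitz Y1, track G2, seat `ne7`, generation 10); text of record
`run/shared/lean/pub/pub-balaban-gaps/ne/NE7.md` (v10: §4undecies (vi)(δ), census R65).  38th `Spine/NE7/` file; 0 `def`, 0 sorry.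

WHY.  File 36 (`QLaCensus`) reduced NODE S's ledger census to a count under two readings of the ledger.  Under reading (b) —
the `t`-constants indexed by the LOCALIZATION DOMAINS of the exponentiated form [Balaban1989LargeFieldI] (0.5)–(0.6), overlapping
connected unions of cubes whose terms carry the decay `exp(−κ d_k(X))` of [Balaban1989LargeFieldII] (1.100) p. 390 — the census
entered as the HYPOTHESIS `hcell` of `multiplicity_of_perCell_census`: the printed per-cube bound [Balaban1987RG1] (0.26) p. 257
(the decayed weights of the scale-`j` domains through one cube sum to `≤ K₀`).  That bound is, for abstract cell systems, the
LATTICE-ANIMAL theorem already in the tree: `Literature.Probability.LatticeModels.sum_pow_card_le_of_connected` (for an adjacency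
`R` with neighbour lists of size `≤ Δ` and `(Δ+1)²·λ ≤ ½`, every finite family of `R`-connected cell sets through a cell `q` has
`Σ λ^{#Y} ≤ 2λ`; Kotecký–Preiss ∕ Friedli–Velenik Thm. 5.4 bookkeeping, proved there from `card_connectedFamily_le`).  This file
is the bridge: (F-conn) every domain of the ledger is an `R`-connected set of cells of its scale and distinct domains of one scale
have distinct cell sets; (F-decay) its weight is at most `C·λ^{#cells}` with `(Δ+1)²λ ≤ ½` — THEN `hcell` holds with `Cw = 2Cλ`
(`perCell_census_of_connected_decay`), hence `Multiplicity fac sc w (2Cλ) vol Λ K` on cell types of size `≤ vol·Λ^{K−j}`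
(`multiplicity_of_connected_decay`), on the cell's tori with `vol = |T^{(K)}|`, `Λ = L^d` (`multiplicity_of_connected_decay_sites`).
In print `λ = e^{−κ}` up to the comparison `d_k(X) ≳ #cubes of X` for connected unions of cubes and the polynomial prefactor of
NODE S's weight `(|w|·|X|·Dm)²`, absorbed by `|X|² λ^{|X|} ≤ C′·λ′^{|X|}` for any `λ < λ′` (file 36 `exists_absorb_pow`, the
same device in the size variable).

HONEST FRAMING.  Finite combinatorics only; (F-conn), (F-decay) are HYPOTHESES named after the printed structure ((0.5)–(0.6),
(1.100), (0.26)), NOT assertions about Bałaban's domains (no object of (2.18) [III] exists in the tree: NODE O); the animal bound is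
the tree's, imported by name.  NE7 NOT proved; spine 0∕9; one fixed finite T⁴ — NOT ℝ⁴, NOT infinite volume, NOT a mass gap, NOT
Clay.  No classification word moves (R10).
-/

noncomputable section

open Finset
open scoped BigOperators

namespace Summit.QuantumFields.BalabanUV.T4Continuum.Spine.NE7

open Literature.MathematicalPhysics.QuantumFieldTheory.Balaban1983to89
open Literature.MathematicalPhysics.QuantumFieldTheory.Balaban1983to89.T4RecentScale (Multiplicity)
open Literature.Probability.LatticeModels (IsRConnected sum_pow_card_le_of_connected)

variable {ι : Type*}

/-- **THE PRINTED PER-CUBE CENSUS FROM CONNECTEDNESS + DECAY** (the (0.26)-type bound as the tree's animal theorem).  Scale-indexed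
cell types `S j` with adjacencies `R j` (symmetric, neighbour lists `nbr j` of size `≤ Δ`); a ledger `fac` with scales `sc` and cell
sets `cells j i`; (F-conn) each entry's cell set is `R`-connected and `cells j` is injective on the scale-`j` slice; (F-decay)
`0 ≤ w i ≤ C·λ^{#cells}` with `(Δ+1)²λ ≤ ½`.  Then for every scale `j` and cell `x`: `Σ_{sc i = j, x ∈ cells i} w i ≤ C·(2λ)`.
[folklore] -/
theorem perCell_census_of_connected_decay {S : ℕ → Type*} [∀ j, DecidableEq (S j)] (fac : Finset ι) (sc : ι → ℕ)
    (cells : (j : ℕ) → ι → Finset (S j)) (w : ι → ℝ) (R : (j : ℕ) → S j → S j → Prop)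
    (nbr : (j : ℕ) → S j → Finset (S j)) {Δ : ℕ} (hR : ∀ j x y, R j x y → R j y x)
    (hΔ : ∀ j x, (nbr j x).card ≤ Δ) (hnbr : ∀ j x y, R j x y → y ∈ nbr j x) {C lam : ℝ} (hC : 0 ≤ C) (hlam : 0 ≤ lam)
    (hsmall : ((Δ : ℝ) + 1) ^ 2 * lam ≤ 1 / 2) (hconn : ∀ i ∈ fac, IsRConnected (R (sc i)) (cells (sc i) i))
    (hinj : ∀ j, Set.InjOn (cells j) ↑(fac.filter fun i => sc i = j))
    (hw : ∀ i ∈ fac, w i ≤ C * lam ^ (cells (sc i) i).card) (j : ℕ) (x : S j) :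
    ∑ i ∈ (fac.filter fun i => sc i = j) with x ∈ cells j i, w i ≤ C * (2 * lam) := by
  set sl : Finset ι := (fac.filter fun i => sc i = j).filter fun i => x ∈ cells j i with hsl
  have hsl_sub : (sl : Set ι) ⊆ ↑(fac.filter fun i => sc i = j) := by
    intro i hi
    exact (mem_filter.mp hi).1
  -- each weight against the decay, at scale j
  have h1 : ∑ i ∈ sl, w i ≤ ∑ i ∈ sl, C * lam ^ (cells j i).card := sum_le_sum fun i hi => by
    obtain ⟨hi', _⟩ := mem_filter.mp hi
    obtain ⟨hif, hij⟩ := mem_filter.mp hi'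
    subst hij
    exact hw i hif
  -- pass to the family of cell sets (injective on the slice)
  have hinj' : Set.InjOn (cells j) ↑sl := (hinj j).mono hsl_sub
  have h2 : ∑ i ∈ sl, lam ^ (cells j i).card = ∑ Y ∈ sl.image (cells j), lam ^ Y.card :=
    (sum_image (f := fun Y : Finset (S j) => lam ^ Y.card) fun a ha b hb h => hinj' ha hb h).symm
  have h𝒴 : ∀ Y ∈ sl.image (cells j), x ∈ Y ∧ IsRConnected (R j) Y := by
    intro Y hY
    obtain ⟨i, hi, rfl⟩ := mem_image.mp hY
    obtain ⟨hi', hx⟩ := mem_filter.mp hi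
    obtain ⟨hif, hij⟩ := mem_filter.mp hi'
    subst hij
    exact ⟨hx, hconn i hif⟩
  have h3 := sum_pow_card_le_of_connected (hR j) (hΔ j) (hnbr j) hlam hsmall x (sl.image (cells j)) h𝒴
  calc ∑ i ∈ sl, w i ≤ ∑ i ∈ sl, C * lam ^ (cells j i).card := h1
    _ = C * ∑ Y ∈ sl.image (cells j), lam ^ Y.card := by rw [← mul_sum, h2]
    _ ≤ C * (2 * lam) := mul_le_mul_of_nonneg_left h3 hC

/-- **MULTIPLICITY FROM CONNECTEDNESS + DECAY** (reading (b) of file 36 made a theorem): under (F-conn) + (F-decay) with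
`0 ≤ w`, and cell types of size `≤ vol·Λ^{K−j}`, `T4RecentScale.Multiplicity fac sc w (C·(2λ)) vol Λ K` — by
`perCell_census_of_connected_decay` and file 36's double counting `multiplicity_of_perCell_census`. [folklore] -/
theorem multiplicity_of_connected_decay {S : ℕ → Type*} [∀ j, Fintype (S j)] [∀ j, DecidableEq (S j)] (fac : Finset ι)
    (sc : ι → ℕ) (cells : (j : ℕ) → ι → Finset (S j)) (w : ι → ℝ) (R : (j : ℕ) → S j → S j → Prop)
    (nbr : (j : ℕ) → S j → Finset (S j)) {Δ : ℕ} (hR : ∀ j x y, R j x y → R j y x)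
    (hΔ : ∀ j x, (nbr j x).card ≤ Δ) (hnbr : ∀ j x y, R j x y → y ∈ nbr j x) {C lam vol Λ : ℝ} {K : ℕ} (hC : 0 ≤ C)
    (hlam : 0 ≤ lam) (hsmall : ((Δ : ℝ) + 1) ^ 2 * lam ≤ 1 / 2)
    (hconn : ∀ i ∈ fac, IsRConnected (R (sc i)) (cells (sc i) i))
    (hinj : ∀ j, Set.InjOn (cells j) ↑(fac.filter fun i => sc i = j)) (hw0 : ∀ i ∈ fac, 0 ≤ w i)
    (hw : ∀ i ∈ fac, w i ≤ C * lam ^ (cells (sc i) i).card)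
    (hcard : ∀ j ≤ K, (Fintype.card (S j) : ℝ) ≤ vol * Λ ^ (K - j)) :
    Multiplicity fac sc w (C * (2 * lam)) vol Λ K :=
  multiplicity_of_perCell_census fac sc cells w (fun i hi => (hconn i hi).1) hw0
    (fun j _ x => perCell_census_of_connected_decay fac sc cells w R nbr hR hΔ hnbr hC hlam hsmall hconn hinj hw j x)
    hcard (mul_nonneg hC (mul_nonneg zero_le_two hlam))

/-- **… ON THE CELL'S TORI** (site cells, any bounded-degree adjacency on each `Site P j`): `vol = |T^{(K)}|`, `Λ = L^d` — the
count is file 36's `card_site_eq_unit_mul`. [folklore] -/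
theorem multiplicity_of_connected_decay_sites {P : Params} (fac : Finset ι) (sc : ι → ℕ)
    (cells : (j : ℕ) → ι → Finset (Site P j)) (w : ι → ℝ) (R : (j : ℕ) → Site P j → Site P j → Prop)
    (nbr : (j : ℕ) → Site P j → Finset (Site P j)) {Δ : ℕ} (hR : ∀ j x y, R j x y → R j y x)
    (hΔ : ∀ j x, (nbr j x).card ≤ Δ) (hnbr : ∀ j x y, R j x y → y ∈ nbr j x) {C lam : ℝ} (hC : 0 ≤ C) (hlam : 0 ≤ lam)
    (hsmall : ((Δ : ℝ) + 1) ^ 2 * lam ≤ 1 / 2) (hconn : ∀ i ∈ fac, IsRConnected (R (sc i)) (cells (sc i) i))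
    (hinj : ∀ j, Set.InjOn (cells j) ↑(fac.filter fun i => sc i = j)) (hw0 : ∀ i ∈ fac, 0 ≤ w i)
    (hw : ∀ i ∈ fac, w i ≤ C * lam ^ (cells (sc i) i).card) :
    Multiplicity fac sc w (C * (2 * lam)) (Fintype.card (Site P P.K)) ((P.L : ℝ) ^ P.d) P.K :=
  multiplicity_of_connected_decay fac sc cells w R nbr hR hΔ hnbr hC hlam hsmall hconn hinj hw0 hw
    fun _ hj => (card_site_eq_unit_mul_real P hj).le

/-- **THE POLYNOMIAL PREFACTOR IS FREE** (NODE S's weight is `(|w|·|X|·Dm)²·decay`): for `0 ≤ λ < λ′` there is `C′ ≥ 0` with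
`(n+1)²·λⁿ ≤ C′·λ′ⁿ` for all `n` — file 36's `exists_absorb_pow` in the size variable; so (F-decay) with a quadratic prefactor
is (F-decay) at any slightly worse rate. [folklore] -/
theorem exists_absorb_sq {lam lam' : ℝ} (hlam : 0 ≤ lam) (hlt : lam < lam') :
    ∃ C' : ℝ, 0 ≤ C' ∧ ∀ n : ℕ, ((n : ℝ) + 1) ^ 2 * lam ^ n ≤ C' * lam' ^ n :=
  exists_absorb_pow 2 hlam hlt

end Summit.QuantumFields.BalabanUV.T4Continuum.Spine.NE7

end
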